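import Mathlib
import Literature.MathematicalPhysics.QuantumLattice.WilsonDiracAP
import Summits.QuantumFields.QCD.Theorems.QuarksAsStableActionCriticalLineDiamagnetismStubCellGainOfGauged

/-!
# Cell data of the reflection tiling read on the `2⁴`-torus
(helper for crux stmt-QuantumFields-9734, line `Sketch`, stub `stub_tilingCellData`)

What.  On the even torus `(ℤ/2M)⁴` let `tile_c V` be the period-2 reflection tiling of the gauge
field `V` about the corner `c`, and let `W_c : Edge 4 2 → U(3)` be the tiling read at the sixteen
representatives `c + a`, `a ∈ {0,1}⁴` (lifted into `ℤ/2M` by `val`).  We prove the finite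
bookkeeping behind the lead's assembly:
(i) every one of the `64` links `W_c (a, μ)` has the same `Re tr` as some CELL link of `V`
(a link `(x, μ)` with all offsets `val (x_ν - c_ν) ≤ 1` and `μ`-offset `0`);
(ii) `Σ_{(a, μ)} (3 - Re tr W_c (a, μ)) ≤ 2 · Σ_{cell links e} (3 - Re tr V e)`.

How.  NORMAL FORM (`TilingCellData.link_eq`): `W_c (a, μ) = V (c + a, μ)` if `a_μ = 0` and
`W_c (a, μ) = V (c + (a + e_μ), μ)⁻¹` if `a_μ = 1` (offsets of `c + a` from `c` are the `val a_ν`;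
in the backward branch `val ((y_μ + 1) - c_μ) mod 2 = (val (y_μ - c_μ) + 1) mod 2` because `2M` is
even, `CellGainOfGauged.zmod_val_add_one_mod_two`).  Since `Re tr u⁻¹ = Re tr u` on `U(3)`, the
deficit of `W_c (a, μ)` is `F (a, μ) + F (a + e_μ, μ)` with `F (a, μ) := [a_μ = 0] · (3 - Re tr V (c + a, μ))`;
`(a, μ) ↦ (a + e_μ, μ)` is an involution of `Edge 4 2`, so the total is `2 Σ F`, and `Σ F ≤ Σ_cell`
because `(a, μ) ↦ (c + a, μ)` is injective and lands in the cell links when `a_μ = 0` (deficits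
are `≥ 0`, `CellGainOfGauged.deficit_nonneg`).  All statements are phrased for a field `T` given by
the defining equation of `tile_c V`, and the cell Finset enters only through a membership
hypothesis (decidability instances are matched by unification).
Sources: folklore lattice bookkeeping; sibling file
`…WilsonQuarkStabilityStubTilingStability` (`trace_re_inv`, link count).  Pure theorem file.
-/

noncomputable section

open scoped BigOperators Classical Matrix ComplexConjugate
open Finset
open Literature.MathematicalPhysics.QuantumLattice Literature.MathematicalPhysics.QuantumFieldTheory
  Literature.Probability.LatticeModels

namespace Summit.QuantumFields.QCD.Cruxes.CriticalLineDiamagnetism.ChessboardCellGain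

namespace TilingCellData

/-! ### Small facts on `U(3)` and `ℤ/2` -/

/-- `Re tr u⁻¹ = Re tr u` on `U(3)` (`u⁻¹ = u†`). -/
theorem trace_re_inv (u : Matrix.unitaryGroup (Fin 3) ℂ) :
    (((u⁻¹ : Matrix.unitaryGroup (Fin 3) ℂ) : Matrix (Fin 3) (Fin 3) ℂ)).trace.re =
      ((u : Matrix (Fin 3) (Fin 3) ℂ)).trace.re := by
  -- adapted from `trace_re_inv` of `…WilsonQuarkStabilityStubTilingStability.lean`
  rw [Matrix.UnitaryGroup.inv_val, Matrix.star_eq_conjTranspose, Matrix.trace_conjTranspose,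
    Complex.star_def, Complex.conj_re]

/-- In `ℤ/2`, `val (x + 1) = (val x + 1) mod 2`. -/
theorem zmod_two_val_add_one (x : ZMod 2) : (x + 1).val = (x.val + 1) % 2 := by
  rw [ZMod.val_add, ZMod.val_one'' (by decide)]

variable {M : ℕ} [NeZero M]

/-- `val a < 2 ≤ 2M` for `a : ℤ/2` and `M ≥ 1`. -/
theorem val_lt_two_mul (x : ZMod 2) : x.val < 2 * M := by
  have hM : M ≠ 0 := NeZero.ne M
  have := ZMod.val_lt x
  omega

/-- Offsets of the representatives from the corner: `val ((c_κ + val a) - c_κ) = val a`. -/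
theorem val_offset (cκ : ZMod (2 * M)) (x : ZMod 2) :
    (cκ + ((x.val : ℕ) : ZMod (2 * M)) - cκ).val = x.val := by
  rw [add_sub_cancel_left, ZMod.val_cast_of_lt (val_lt_two_mul x)]

/-! ### The two sites read by a link of `W_c` -/

/-- The forward site of the link `W_c (a, μ)` is the representative `c + a` itself. -/
theorem site_then (c : Site 4 (2 * M)) (a : Fin 4 → ZMod 2) :
    (fun ν => c ν + ((((c ν + (((a ν).val : ℕ) : ZMod (2 * M))) - c ν).val % 2 : ℕ) : ZMod (2 * M))) =
      fun ν => c ν + (((a ν).val : ℕ) : ZMod (2 * M)) := by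
  funext ν
  rw [val_offset (c ν) (a ν), Nat.mod_eq_of_lt (ZMod.val_lt (a ν))]

/-- The backward site of the link `W_c (a, μ)` is the representative `c + (a + e_μ)`
(this uses that `2M` is even). -/
theorem site_else (c : Site 4 (2 * M)) (a : Fin 4 → ZMod 2) (μ : Fin 4) :
    (fun ν => c ν + (((Site.shift (fun κ => c κ + (((a κ).val : ℕ) : ZMod (2 * M))) μ ν - c ν).val % 2 :
        ℕ) : ZMod (2 * M))) =
      fun ν => c ν + ((((a + Pi.single μ 1 : Fin 4 → ZMod 2) ν).val : ℕ) : ZMod (2 * M)) := by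
  funext ν
  rw [Pi.add_apply]
  by_cases hν : ν = μ
  · subst hν
    rw [FreeDetFormula.shift_apply_self, Pi.single_eq_same, zmod_two_val_add_one, add_sub_right_comm,
      CellGainOfGauged.zmod_val_add_one_mod_two (even_two_mul M), val_offset (c ν) (a ν)]
  · rw [FreeDetFormula.shift_apply_of_ne _ hν, Pi.single_eq_of_ne hν, add_zero, val_offset (c ν) (a ν),
      Nat.mod_eq_of_lt (ZMod.val_lt (a ν))]

/-- A representative `c + a` with `a_μ = 0` is the base point of a cell link in direction `μ`:
all offsets `≤ 1`, `μ`-offset `0`. -/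
theorem cell_link_mem (c : Site 4 (2 * M)) (a : Fin 4 → ZMod 2) (μ : Fin 4) (h : a μ = 0) :
    (∀ ν, (c ν + (((a ν).val : ℕ) : ZMod (2 * M)) - c ν).val ≤ 1) ∧
      (c μ + (((a μ).val : ℕ) : ZMod (2 * M)) - c μ).val = 0 := by
  refine ⟨fun ν => ?_, ?_⟩
  · rw [val_offset (c ν) (a ν)]
    have := ZMod.val_lt (a ν)
    omega
  · rw [val_offset (c μ) (a μ), h, ZMod.val_zero]

variable (V : GaugeConfig 4 (2 * M) (Matrix.unitaryGroup (Fin 3) ℂ)) (c : Site 4 (2 * M))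
  {T : GaugeConfig 4 (2 * M) (Matrix.unitaryGroup (Fin 3) ℂ)}

/-! ### Normal form of the links of `W_c` -/

/-- **Normal form.**  If `T` satisfies the defining equation of `tile_c V`, then its link read at the
representative `c + a` in direction `μ` is `V (c + a, μ)` when `a_μ = 0` and `V (c + (a + e_μ), μ)⁻¹`
when `a_μ = 1`. -/
theorem link_eq
    (hT : ∀ (x : Site 4 (2 * M)) (μ : Fin 4), T (x, μ) = if (x μ - c μ).val % 2 = 0
        then V (fun ν => c ν + (((x ν - c ν).val % 2 : ℕ) : ZMod (2 * M)), μ)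
        else (V (fun ν => c ν + (((Site.shift x μ ν - c ν).val % 2 : ℕ) : ZMod (2 * M)), μ))⁻¹)
    (a : Fin 4 → ZMod 2) (μ : Fin 4) :
    T (fun ν => c ν + (((a ν).val : ℕ) : ZMod (2 * M)), μ) =
      if a μ = 0 then V (fun ν => c ν + (((a ν).val : ℕ) : ZMod (2 * M)), μ)
      else (V (fun ν => c ν +
        ((((a + Pi.single μ 1 : Fin 4 → ZMod 2) ν).val : ℕ) : ZMod (2 * M)), μ))⁻¹ := by
  have hcond : ((c μ + (((a μ).val : ℕ) : ZMod (2 * M))) - c μ).val % 2 = 0 ↔ a μ = 0 := by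
    rw [val_offset (c μ) (a μ), Nat.mod_eq_of_lt (ZMod.val_lt (a μ)), ZMod.val_eq_zero]
  rw [hT]
  by_cases h : a μ = 0
  · rw [if_pos h]
    exact (if_pos (hcond.2 h)).trans (congrArg (fun s : Site 4 (2 * M) => V (s, μ)) (site_then c a))
  · rw [if_neg h]
    exact (if_neg (mt hcond.1 h)).trans
      (congrArg (fun s : Site 4 (2 * M) => (V (s, μ))⁻¹) (site_else c a μ))

/-- **Deficit of a link of `W_c`** as `F (a, μ) + F (a + e_μ, μ)` with
`F (a, μ) := [a_μ = 0] · (3 - Re tr V (c + a, μ))` (uses `Re tr u⁻¹ = Re tr u`). -/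
theorem deficit_link_eq
    (hT : ∀ (x : Site 4 (2 * M)) (μ : Fin 4), T (x, μ) = if (x μ - c μ).val % 2 = 0
        then V (fun ν => c ν + (((x ν - c ν).val % 2 : ℕ) : ZMod (2 * M)), μ)
        else (V (fun ν => c ν + (((Site.shift x μ ν - c ν).val % 2 : ℕ) : ZMod (2 * M)), μ))⁻¹)
    (a : Fin 4 → ZMod 2) (μ : Fin 4) :
    3 - ((T (fun ν => c ν + (((a ν).val : ℕ) : ZMod (2 * M)), μ) : Matrix.unitaryGroup (Fin 3) ℂ) :
        Matrix (Fin 3) (Fin 3) ℂ).trace.re =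
      (if a μ = 0 then 3 - ((V (fun ν => c ν + (((a ν).val : ℕ) : ZMod (2 * M)), μ) :
          Matrix.unitaryGroup (Fin 3) ℂ) : Matrix (Fin 3) (Fin 3) ℂ).trace.re else 0) +
      (if (a + Pi.single μ 1 : Fin 4 → ZMod 2) μ = 0 then 3 - ((V (fun ν => c ν +
          ((((a + Pi.single μ 1 : Fin 4 → ZMod 2) ν).val : ℕ) : ZMod (2 * M)), μ) :
          Matrix.unitaryGroup (Fin 3) ℂ) : Matrix (Fin 3) (Fin 3) ℂ).trace.re else 0) := by
  have hflip : (a + Pi.single μ 1 : Fin 4 → ZMod 2) μ = a μ + 1 := by rw [Pi.add_apply, Pi.single_eq_same]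
  rw [link_eq V c hT a μ, hflip]
  by_cases h : a μ = 0
  · rw [if_pos h, if_pos h, if_neg (by rw [h]; decide), add_zero]
  · rw [if_neg h, if_neg h, if_pos ((by decide : ∀ x : ZMod 2, x ≠ 0 → x + 1 = 0) _ h), zero_add,
      trace_re_inv]

/-! ### Part (i): every link of `W_c` has the trace of a cell link -/

/-- **Part (i).**  Every link of `W_c` has the same `Re tr` as a cell link of `V` (it is that link
or its inverse). -/
theorem exists_cell_link
    (hT : ∀ (x : Site 4 (2 * M)) (μ : Fin 4), T (x, μ) = if (x μ - c μ).val % 2 = 0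
        then V (fun ν => c ν + (((x ν - c ν).val % 2 : ℕ) : ZMod (2 * M)), μ)
        else (V (fun ν => c ν + (((Site.shift x μ ν - c ν).val % 2 : ℕ) : ZMod (2 * M)), μ))⁻¹)
    (e : Edge 4 2) :
    ∃ e' : Edge 4 (2 * M), ((∀ ν, (e'.1 ν - c ν).val ≤ 1) ∧ (e'.1 e'.2 - c e'.2).val = 0) ∧
      ((T (fun ν => c ν + (((e.1 ν).val : ℕ) : ZMod (2 * M)), e.2) : Matrix.unitaryGroup (Fin 3) ℂ) :
          Matrix (Fin 3) (Fin 3) ℂ).trace.re =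
        ((V e' : Matrix.unitaryGroup (Fin 3) ℂ) : Matrix (Fin 3) (Fin 3) ℂ).trace.re := by
  rw [link_eq V c hT e.1 e.2]
  by_cases h : e.1 e.2 = 0
  · rw [if_pos h]
    exact ⟨(fun ν => c ν + (((e.1 ν).val : ℕ) : ZMod (2 * M)), e.2), cell_link_mem c e.1 e.2 h, rfl⟩
  · rw [if_neg h, trace_re_inv]
    refine ⟨(fun ν => c ν +
        ((((e.1 + Pi.single e.2 1 : Fin 4 → ZMod 2) ν).val : ℕ) : ZMod (2 * M)), e.2),
      cell_link_mem c (e.1 + Pi.single e.2 1 : Fin 4 → ZMod 2) e.2 ?_, rfl⟩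
    rw [Pi.add_apply, Pi.single_eq_same]
    exact (by decide : ∀ x : ZMod 2, x ≠ 0 → x + 1 = 0) _ h

/-! ### Part (ii): the total deficit of `W_c` is at most twice the total cell deficit -/

/-- The forward halves inject into the cell links:
`Σ_{(a, μ) : a_μ = 0} (3 - Re tr V (c + a, μ)) ≤ Σ_{cell links} (3 - Re tr V)`. -/
theorem sum_indicator_le {S : Finset (Edge 4 (2 * M))}
    (hS : ∀ e : Edge 4 (2 * M), ((∀ ν, (e.1 ν - c ν).val ≤ 1) ∧ (e.1 e.2 - c e.2).val = 0) → e ∈ S) :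
    ∑ e : Edge 4 2, (if e.1 e.2 = 0 then 3 - ((V (fun ν => c ν + (((e.1 ν).val : ℕ) : ZMod (2 * M)), e.2) :
        Matrix.unitaryGroup (Fin 3) ℂ) : Matrix (Fin 3) (Fin 3) ℂ).trace.re else 0) ≤
      ∑ e ∈ S, (3 - ((V e : Matrix.unitaryGroup (Fin 3) ℂ) : Matrix (Fin 3) (Fin 3) ℂ).trace.re) := by
  have hinj : Set.InjOn
      (fun e : Edge 4 2 => ((fun ν => c ν + (((e.1 ν).val : ℕ) : ZMod (2 * M))), e.2))
      ↑(univ.filter fun e : Edge 4 2 => e.1 e.2 = 0) := by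
    rintro ⟨a, μ⟩ - ⟨b, μ'⟩ - h
    simp only [Prod.mk.injEq] at h
    obtain ⟨hab, rfl⟩ := h
    rw [Prod.mk.injEq]
    refine ⟨funext fun κ => ?_, rfl⟩
    have hκ : c κ + (((a κ).val : ℕ) : ZMod (2 * M)) = c κ + (((b κ).val : ℕ) : ZMod (2 * M)) :=
      congrFun hab κ
    have hv := congrArg ZMod.val (add_left_cancel hκ)
    rw [ZMod.val_cast_of_lt (val_lt_two_mul (a κ)), ZMod.val_cast_of_lt (val_lt_two_mul (b κ))] at hv
    exact ZMod.val_injective 2 hv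
  have hmaps : ∀ e ∈ univ.filter (fun e : Edge 4 2 => e.1 e.2 = 0),
      ((fun ν => c ν + (((e.1 ν).val : ℕ) : ZMod (2 * M))), e.2) ∈ S :=
    fun e he => hS _ (cell_link_mem c e.1 e.2 (Finset.mem_filter.1 he).2)
  calc ∑ e : Edge 4 2, (if e.1 e.2 = 0 then 3 - ((V (fun ν => c ν + (((e.1 ν).val : ℕ) : ZMod (2 * M)), e.2) :
          Matrix.unitaryGroup (Fin 3) ℂ) : Matrix (Fin 3) (Fin 3) ℂ).trace.re else 0)
      = ∑ e ∈ univ.filter (fun e : Edge 4 2 => e.1 e.2 = 0),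
          (3 - ((V ((fun ν => c ν + (((e.1 ν).val : ℕ) : ZMod (2 * M))), e.2) :
            Matrix.unitaryGroup (Fin 3) ℂ) : Matrix (Fin 3) (Fin 3) ℂ).trace.re) :=
        (Finset.sum_filter _ _).symm
    _ = ∑ e ∈ (univ.filter (fun e : Edge 4 2 => e.1 e.2 = 0)).image
          (fun e : Edge 4 2 => ((fun ν => c ν + (((e.1 ν).val : ℕ) : ZMod (2 * M))), e.2)),
          (3 - ((V e : Matrix.unitaryGroup (Fin 3) ℂ) : Matrix (Fin 3) (Fin 3) ℂ).trace.re) :=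
        (Finset.sum_image (f := fun e : Edge 4 (2 * M) =>
          3 - ((V e : Matrix.unitaryGroup (Fin 3) ℂ) : Matrix (Fin 3) (Fin 3) ℂ).trace.re) hinj).symm
    _ ≤ ∑ e ∈ S, (3 - ((V e : Matrix.unitaryGroup (Fin 3) ℂ) : Matrix (Fin 3) (Fin 3) ℂ).trace.re) :=
        Finset.sum_le_sum_of_subset_of_nonneg (Finset.image_subset_iff.2 hmaps)
          fun e _ _ => CellGainOfGauged.deficit_nonneg _

/-- **Part (ii).**  `Σ_{64 links} (3 - Re tr W_c) ≤ 2 · Σ_{cell links} (3 - Re tr V)`: by the normal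
form the left-hand side is `Σ F + Σ F ∘ φ = 2 Σ F` for the involution `φ (a, μ) = (a + e_μ, μ)` of
`Edge 4 2`, and `Σ F ≤ Σ_cell` (`sum_indicator_le`). -/
theorem sum_deficit_le
    (hT : ∀ (x : Site 4 (2 * M)) (μ : Fin 4), T (x, μ) = if (x μ - c μ).val % 2 = 0
        then V (fun ν => c ν + (((x ν - c ν).val % 2 : ℕ) : ZMod (2 * M)), μ)
        else (V (fun ν => c ν + (((Site.shift x μ ν - c ν).val % 2 : ℕ) : ZMod (2 * M)), μ))⁻¹)
    {S : Finset (Edge 4 (2 * M))}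
    (hS : ∀ e : Edge 4 (2 * M), ((∀ ν, (e.1 ν - c ν).val ≤ 1) ∧ (e.1 e.2 - c e.2).val = 0) → e ∈ S) :
    ∑ e : Edge 4 2, (3 - ((T (fun ν => c ν + (((e.1 ν).val : ℕ) : ZMod (2 * M)), e.2) :
        Matrix.unitaryGroup (Fin 3) ℂ) : Matrix (Fin 3) (Fin 3) ℂ).trace.re) ≤
      2 * ∑ e ∈ S, (3 - ((V e : Matrix.unitaryGroup (Fin 3) ℂ) : Matrix (Fin 3) (Fin 3) ℂ).trace.re) := by
  have hφ : Function.Bijective (fun e : Edge 4 2 => ((e.1 + Pi.single e.2 1 : Fin 4 → ZMod 2), e.2)) :=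
    Function.Involutive.bijective fun e => by
      show ((e.1 + Pi.single e.2 1 + Pi.single e.2 1 : Fin 4 → ZMod 2), e.2) = e
      rw [add_assoc, ← Pi.single_add, show (1 : ZMod 2) + 1 = 0 from by decide, Pi.single_zero,
        add_zero]
  calc ∑ e : Edge 4 2, (3 - ((T (fun ν => c ν + (((e.1 ν).val : ℕ) : ZMod (2 * M)), e.2) :
          Matrix.unitaryGroup (Fin 3) ℂ) : Matrix (Fin 3) (Fin 3) ℂ).trace.re)
      = ∑ e : Edge 4 2,
          ((if e.1 e.2 = 0 then 3 - ((V (fun ν => c ν + (((e.1 ν).val : ℕ) : ZMod (2 * M)), e.2) :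
              Matrix.unitaryGroup (Fin 3) ℂ) : Matrix (Fin 3) (Fin 3) ℂ).trace.re else 0) +
            (if (e.1 + Pi.single e.2 1 : Fin 4 → ZMod 2) e.2 = 0 then 3 - ((V (fun ν => c ν +
              ((((e.1 + Pi.single e.2 1 : Fin 4 → ZMod 2) ν).val : ℕ) : ZMod (2 * M)), e.2) :
              Matrix.unitaryGroup (Fin 3) ℂ) : Matrix (Fin 3) (Fin 3) ℂ).trace.re else 0)) :=
        Finset.sum_congr rfl fun e _ => deficit_link_eq V c hT e.1 e.2
    _ = 2 * ∑ e : Edge 4 2, (if e.1 e.2 = 0 then 3 - ((V (fun ν => c ν +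
          (((e.1 ν).val : ℕ) : ZMod (2 * M)), e.2) :
          Matrix.unitaryGroup (Fin 3) ℂ) : Matrix (Fin 3) (Fin 3) ℂ).trace.re else 0) := by
        rw [Finset.sum_add_distrib, (two_mul _ : (2 : ℝ) * _ = _)]
        congr 1
        exact Fintype.sum_bijective _ hφ _ _ fun _ => rfl
    _ ≤ 2 * ∑ e ∈ S, (3 - ((V e : Matrix.unitaryGroup (Fin 3) ℂ) : Matrix (Fin 3) (Fin 3) ℂ).trace.re) :=
        mul_le_mul_of_nonneg_left (sum_indicator_le V c hS) zero_le_two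

end TilingCellData

/-- **Stub `stub_tilingCellData` (cell data of the tiling on the `2⁴`-torus).**  For the cell field
`W_c` of the period-2 reflection tiling `tile_c V` read at the representatives `c + a`, `a ∈ {0,1}⁴`,
on the even torus `(ℤ/2M)⁴`: (i) every one of its `64` links has the same `Re tr` as some cell link of
`V` (offsets `val (x_ν - c_ν) ≤ 1`, `μ`-offset `0`) — it is that link or its inverse; (ii) the total
link deficit of `W_c` is at most twice the total deficit of the `32` cell links
(`TilingCellData.exists_cell_link`, `TilingCellData.sum_deficit_le`). -/
theorem stub_tilingCellData : ∀ (M : ℕ) [NeZero M] (V : GaugeConfig 4 (2 * M) (Matrix.unitaryGroup (Fin 3) ℂ)) (c : Site 4 (2 * M)), let tile : Site 4 (2 * M) → GaugeConfig 4 (2 * M) (Matrix.unitaryGroup (Fin 3) ℂ) → GaugeConfig 4 (2 * M) (Matrix.unitaryGroup (Fin 3) ℂ) := fun c V e => if (e.1 e.2 - c e.2).val % 2 = 0 then V (fun ν => c ν + (((e.1 ν - c ν).val % 2 : ℕ) : ZMod (2 * M)), e.2) else (V (fun ν => c ν + (((Site.shift e.1 e.2 ν - c ν).val % 2 : ℕ)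 : ZMod (2 * M)), e.2))⁻¹; let Wc : GaugeConfig 4 2 (Matrix.unitaryGroup (Fin 3) ℂ) := fun e => tile c V (fun ν => c ν + (((e.1 ν).val : ℕ) : ZMod (2 * M)), e.2); (∀ e : Edge 4 2, ∃ e' : Edge 4 (2 * M), ((∀ ν, (e'.1 ν - c ν).val ≤ 1) ∧ (e'.1 e'.2 - c e'.2).val = 0) ∧ ((Wc e : Matrix.unitaryGroup (Fin 3) ℂ) : Matrix (Fin 3) (Fin 3) ℂ).trace.re = ((V e' : Matrix.unitaryGroup (Fin 3) ℂ) : Matrix (Fin 3) (Fin 3) ℂ).trace.re) ∧ ∑ e : Edge 4 2, (3 - ((Wc e : Matrix.unitaryGroup (Fin 3) ℂ) : Matrix (Fin 3) (Fin 3) ℂ).trace.re) ≤ 2 * ∑ e ∈ univ.filter (fun e : Edge 4 (2 * M) => (∀ ν, (e.1 ν - c ν).val ≤ 1) ∧ (e.1 e.2 - c e.2).val = 0), (3 - ((V e : Matrix.unitaryGroup (Fin 3) ℂ) : Matrix (Fin 3) (Fin 3) ℂ).trace.re) := by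
  intro M _ V c tile Wc
  exact ⟨fun e => TilingCellData.exists_cell_link V c (T := tile c V) (fun _ _ => rfl) e,
    TilingCellData.sum_deficit_le V c (T := tile c V) (fun _ _ => rfl) fun e he =>
      Finset.mem_filter.2 ⟨Finset.mem_univ _, he⟩⟩

end Summit.QuantumFields.QCD.Cruxes.CriticalLineDiamagnetism.ChessboardCellGain

end
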